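import Summits.QuantumFields.YangMills.Theorems.BalabanUVNodesN11Sect3SupplyChainNodeAtNumerics
import Literature.MathematicalPhysics.QuantumFieldTheory.Balaban1983to89.Node00.N24ItemsStage13AtThm1CCMWOfStepRSignFreeAllTorusSepCoPH

/-!
# DAG node N11 — THE N11 SIDE OF THE RE-KEYED K1 WITNESS: K⁷'s ANTECEDENT, N11's `hT` ∕ `h11` TYPE AND N13's (R₁₃) LEAF AT dag-n11-w1's NAMED GAUSSIAN CERTIFICATE
# `θᴳ := gaussPinH (Stage13HParams.ofHistoryBlind F N ⟨θ₁₅ᶜᶜᴹᵂ(j; γ), Zr⟩)` OF K1's WITNESS OF RECORD — so that dag-n24-c's Part 14 ∕ 34H ∕ 35H can switch `θᴴ ↦ θᴳ` BY NAME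

Cell `pub-ymgap`, YM-PLAN Track A (HUMAN RULING D-0062 ∕ D-0149 ∕ D-0154), WIDTH SEAT `pub-ymgap-dag-n11-w6` (g0; R399 (3a) second wave on NODE n11 [B14]), route `BalabanUVNodes`
rev 25 (v1.7 `CoPH` key), item K1⁷ `StabilityBAtRecordR13SepCoPH` = stmt-QuantumFields-20542 (`--kind proof --supports 20542 --as helper`, count-neutral).  dag-n11-e g19's HAND-OUT X6
(pub-ymgap INBOX 2026-08-28T05:07Z, l.29059).  [III] = [Balaban1988Convergent], [IV] = [Balaban1989LargeFieldI], [B16] = [Balaban1989LargeFieldII], [15] = [Balaban1985Variational].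

WHY.  dag-n24-c's split closers of K1⁷ (Part 14 `Node00/N24ItemsStage13AtThm1CCMWOfStepRSignFreeAllTorusSepCoPH`, 34H p606032 `…N24ChildrenSplitN07N11N13Suppliers`, 35H) key the K1
witness at the BARE history-blind door `θᴴ := Stage13HParams.ofHistoryBlind F N ⟨theta13OfThm1CCMW F N j γ ε₀ ε₂₉ B₃ B₃' a₀ a₁, ZrOfRecord₁₃ F N (…)⟩`, whose history-indexed residual
slot is K0a's all-large-diagonal pin `Zh p n Ω Λ := ZrOfRecord₁₃ … p` — HISTORY-BLIND (dag-n11-e g19 LOCATED-ZH; dag-n11-d p538518 `not_exists_historyBlind_pointwise_pin`: off the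
diagonal no history-blind value serves the no-expansion clause).  So the `NoExpansionObligation` half of N11's residual `SupplyChainAt θᴴ P` — hence 34H's `h11` at THAT `θᴴ` — is
what no N11 lane discharges; the tree discharges it in the ZhPin class, at dag-n11-w1's named Gaussian certificate `gaussPinH` (p590080: certificate `ζ0`, A-fibre Gaussian `quad`;
Stage-13 part UNCHANGED, `gaussPinH_toStage13Params`, so every `θ₁₅ᶜᶜᴹᵂ`-keyed numeric ∕ leaf ∕ β-of-record face is `rfl`-unchanged).  THIS FILE is the N11 side of the switch
`θᴴ ↦ θᴳ := gaussPinH θᴴ`, BY NAME, zero re-typing: (§0) `rfl` faces of `θᴳ`; (§1) K⁷'s antecedent `Provisos₁₃SepCoPH ∧ (ZhUnity ∧ SlotsNondegenerate₁₃) ∧ Admissible` at `θᴳ`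
from ANY door proof `hP : θᴴ.Provisos₁₃SepCoPH` (dag-n11-w1 `antecedent_gaussPinH`, `ZhUnity` unconditional) — and keyed on dag-n24-c's door letters (Part 14 §0c
`N24_provisos₁₃SepCoPH_door_theta13OfThm1CCMW_of_gauge9TopStepR_of_betaBoxSignFree_allTorus`, dag-n21-c `slotsNondegenerate₁₃_theta13OfThm1CCMW` ∕ `admissible_theta13OfThm1CCMW_of_le_half`);
(§2) N11's `hT` binder `∀ P k, k < P.K → SLaw₁₃CoPH θᴳ P k → TLaw₁₃CoPH θᴳ P k` from `hrec : θᴴ.Provisos₁₃CoPH` + [III] §3's `SupplierObligations` + def-T's `OperandRowsAlongChain`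
AT `θᴳ` — NOTHING ELSE (dag-n11-e g19 p606248 §3c `thmP245Laws_all_gaussPinH_theta13OfThm1CCMWH_of_obligations_of_operandRows`, `hθ := rfl`), the `h11` TYPE at `θᴳ`'s SepCoPH datum in
34H §1's shape (world, letters and leaf antecedents UNREAD, `γ₁₁ := 1`; any door proof `hG`), the per-world `h11` slot of the generic door theorem
`N24_stabilityBR13SepCoPH_thetaShape20_rebindX_fourPin_pointed`, Theorem 1 all levels, N11's node `Dag.B14_main` at every world bound to `θᴳ`'s datum, and [III]'s Theorem p.245 AS
PRINTED at `θᴳ` (34H §2's `h245`); (§3) N13's (R₁₃) leaf `ROpLeaf (VOfRecord₁₃CoPH θᴳ P)` ∕ `∀ k < K, TLaw → SLaw (k+1)` at `θᴳ` from the window + six signs (Part 8 §0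
`N24_rOpLeaf_VOfRecord₁₃CoPH_theta13OfThm1CCMW` ∕ `N24_laws₁₃CoPH_theta13OfThm1CCMW` at the free residual slots `(Zr, θᴳ.Zh, θᴳ.Phih)` — `θᴳ` IS that tuple, `rfl`).  With §1–§3 the generic
door theorem instantiates at `θ := θᴳ` with `hP ∕ hθ ∕ hU ∕ h11 ∕ hR` supplied by name; the other children (N05–N10, N12, (UV₁₃)) and the β rows read `θ.toStage13Params = θ₁₅ᶜᶜᴹᵂ` only.

HONEST FRAMING ∕ A6.  Count-neutral kernel composition BY NAME; every proof is ONE application.  `SupplierObligations` ([III] §3 ∕ Thm 2 — nobody's theorem yet), `OperandRowsAlongChain`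
(def-T), `hrec` ∕ the door letters ((8) `VariationalThm1RegSepCoP7M`, [15] Sect. F's R (9)-step `Gauge9RegSepTopStepR`, the sign-free windowed β-box and its two letters, the window
`0 < γ ≤ ½`, the six signs) are DISPLAYED HYPOTHESES, never discharged here; the Gaussian `quad` is a RANGE value serving the no-expansion analysis (dag-n11-w1∕w4's caveat), NOT
node00-def-K0b's value of record; nothing of Bałaban's analysis is asserted or proved.  N11 NOT discharged; K1⁷ NOT closed, NOT claimed; no stub closed; N24 stays COMPOSITE; counts
unmoved (typed 28∕28 · discharged 5∕27).  No summit statement is proved by this seat: `route-QuantumFields-BalabanUVNodes` closes ONLY the CONDITIONAL finite-𝕋⁴ rung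
`BalabanLadder.UV` of one programme at fixed `ε = L^{−K}` — NOT ℝ⁴, NOT OS, NOT the Yang–Mills mass gap (Clay).  No `sorry`, `axiom`, `def`, `instance`, `notation`.
Sources (SHAPE only): [III] Theorem p.245, Thm 1 p.262, remark p.262, §3 p.279, (2.21) p.258, (3.16)–(3.22) pp.268–269, (3.23)–(3.25) p.270, p.244 L36–38; [IV] (0.2)–(0.4) p.176;
[B16] Thm 1 + (0.1) pp.355–356; [15] Thm 1 (8)–(9) p.279; [Balaban1987RG1] Thm 1 p.259, §1 p.264.
-/

noncomputable section

open MeasureTheory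
open scoped BigOperators ENNReal NNReal Matrix.Norms.L2Operator

namespace Summit.QuantumFields.YangMills.Theorems.BalabanUVNodesN11K1WitnessGaussPinH

open Literature.MathematicalPhysics.QuantumFieldTheory.Balaban1983to89 T4Continuum Node00 Node00.Tk DagBinding T4DatumAssembly FlowStepRuns AveragingRT
open FlowStep (BetaLowerH BetaUpperH)
open BalabanUVNodesN11Sect3SupplyChainDefs (Sect3Supplier)
open BalabanUVNodesN11Sect3SupplyChainObligationsDefs
open BalabanUVNodesN11Sect3SupplyChainNode (thmP245PrintedI_of_obligations b14_main_of_obligations)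
open BalabanUVNodesN11GaussianCertificateDefs (gaussPinH gaussPinH_ζ0 gaussPinH_quad provisos₁₃CoPH_gaussPinH antecedent_gaussPinH gaussPinH_toStage13Params)
open BalabanUVNodesN11Sect3SupplyChainNodeAtNumerics

variable {F : T4Family} {N : ℕ} [NeZero N]

/-! ## §0  `rfl` faces of `θᴳ := gaussPinH (Stage13HParams.ofHistoryBlind F N ⟨θ₁₅ᶜᶜᴹᵂ, Zr⟩)` — the Stage-13 part is K1's witness `θ₁₅ᶜᶜᴹᵂ(j; γ)` itself -/

section Faces

variable (j : ℕ) (γ ε₀ ε₂₉ B₃ B₃' a₀ a₁ : ℝ) (Zr : (q : B12.RunParams) → TkResidualW F N (FluctV N) q.K)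

/-- The Stage-13 part of `θᴳ` IS `θ₁₅ᶜᶜᴹᵂ(j; γ)` (`rfl`): every `θ₁₅ᶜᶜᴹᵂ`-keyed numeric, leaf and β-of-record face of dag-n24-c's Parts 14∕30H∕34H∕35H is unchanged under `θᴴ ↦ θᴳ`.
[cite: Balaban1988Convergent, (3.16) p.268 (bookkeeping)] -/
theorem gaussPinH_ofHistoryBlind_toStage13Params :
    (gaussPinH (Stage13HParams.ofHistoryBlind F N ⟨theta13OfThm1CCMW F N j γ ε₀ ε₂₉ B₃ B₃' a₀ a₁, Zr⟩)).toStage13Params = theta13OfThm1CCMW F N j γ ε₀ ε₂₉ B₃ B₃' a₀ a₁ := rfl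

/-- The Stage-13R part of `θᴳ` is `⟨θ₁₅ᶜᶜᴹᵂ, Zr⟩` (`rfl`). [cite: Balaban1988Convergent, (3.16) p.268 (bookkeeping)] -/
theorem gaussPinH_ofHistoryBlind_toStage13RParams :
    (gaussPinH (Stage13HParams.ofHistoryBlind F N ⟨theta13OfThm1CCMW F N j γ ε₀ ε₂₉ B₃ B₃' a₀ a₁, Zr⟩)).toStage13RParams = ⟨theta13OfThm1CCMW F N j γ ε₀ ε₂₉ B₃ B₃' a₀ a₁, Zr⟩ := rfl

/-- The β of record read by the K1 run rows ∕ box letters is unchanged under `θᴴ ↦ θᴳ` (`rfl`). [cite: Balaban1987RG1, (1.20)–(1.22) p.264 (bookkeeping)] -/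
theorem betaOfRecord₁₃_gaussPinH_ofHistoryBlind :
    betaOfRecord₁₃ F N (gaussPinH (Stage13HParams.ofHistoryBlind F N ⟨theta13OfThm1CCMW F N j γ ε₀ ε₂₉ B₃ B₃' a₀ a₁, Zr⟩)).toStage13Params =
      betaOfRecord₁₃ F N (theta13OfThm1CCMW F N j γ ε₀ ε₂₉ B₃ B₃' a₀ a₁) := rfl

/-- `θᴳ` IS the free-residual-slots tuple `⟨⟨θ₁₅ᶜᶜᴹᵂ, Zr⟩, θᴳ.Zh, θᴳ.Phih⟩` of dag-n24-c's Part 8 §1 (`rfl`), so every Part 8 §0∕§1 theorem at free slots instantiates at `θᴳ`.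
[cite: Balaban1988Convergent, (3.16)–(3.20) pp.268–269 (bookkeeping)] -/
theorem gaussPinH_ofHistoryBlind_eq_tuple :
    gaussPinH (Stage13HParams.ofHistoryBlind F N ⟨theta13OfThm1CCMW F N j γ ε₀ ε₂₉ B₃ B₃' a₀ a₁, Zr⟩) =
      (⟨⟨theta13OfThm1CCMW F N j γ ε₀ ε₂₉ B₃ B₃' a₀ a₁, Zr⟩,
        (gaussPinH (Stage13HParams.ofHistoryBlind F N ⟨theta13OfThm1CCMW F N j γ ε₀ ε₂₉ B₃ B₃' a₀ a₁, Zr⟩)).Zh,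
        (gaussPinH (Stage13HParams.ofHistoryBlind F N ⟨theta13OfThm1CCMW F N j γ ε₀ ε₂₉ B₃ B₃' a₀ a₁, Zr⟩)).Phih⟩ : Stage13HParams F N) := rfl

/-- The smearing slot of `θᴳ` is the door's history-blind one `(θ₁₅ᶜᶜᴹᵂ.Rz p.K).phi` (`rfl`); only the residual 𝐓-weight slot `Zh` differs from `θᴴ`'s.
[cite: Balaban1988Convergent, (2.24)–(2.25) p.259 (bookkeeping)] -/
theorem gaussPinH_ofHistoryBlind_Phih :
    (gaussPinH (Stage13HParams.ofHistoryBlind F N ⟨theta13OfThm1CCMW F N j γ ε₀ ε₂₉ B₃ B₃' a₀ a₁, Zr⟩)).Phih =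
      fun (p : B12.RunParams) _ _ _ => ((theta13OfThm1CCMW F N j γ ε₀ ε₂₉ B₃ B₃' a₀ a₁).Rz p.K).phi := rfl

end Faces

/-! ## §1  K⁷'s ANTECEDENT AT `θᴳ`: from any door proof at `θᴴ` (general `Zr`), and keyed on dag-n24-c's door letters (`Zr := ZrOfRecord₁₃ F N θ₁₅ᶜᶜᴹᵂ`) -/

section Antecedent

variable {j : ℕ} {γ ε₀ ε₂₉ B₃ B₃' a₀ a₁ : ℝ}

/-- **★ K⁷'s ANTECEDENT AT `θᴳ` FROM ANY DOOR PROOF AT `θᴴ`** (general run-indexed residual `Zr`): `Provisos₁₃SepCoPH ∧ (ZhUnity ∧ SlotsNondegenerate₁₃) ∧ Admissible` at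
`gaussPinH (Stage13HParams.ofHistoryBlind F N ⟨θ₁₅ᶜᶜᴹᵂ, Zr⟩)` from `hP` (dag-n11-w1 `antecedent_gaussPinH`: `ZhUnity` UNCONDITIONAL at the certificate; non-degeneracy and admissibility
read the Stage-13 part only — dag-n21-c `slotsNondegenerate₁₃_theta13OfThm1CCMW`, `admissible_theta13OfThm1CCMW_of_le_half` from the window `0 < γ ≤ ½` + six signs).
[cite: Balaban1988Convergent, Thm 1 p.262, (2.6)–(2.8) pp.255–256, (3.16)–(3.22) pp.268–269; Balaban1987RG1, Thm 1 p.259; Balaban1989LargeFieldI, (0.2)–(0.4) p.176 (bookkeeping)] -/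
theorem antecedent_gaussPinH_ofHistoryBlind_theta13OfThm1CCMW (hγ₀ : 0 < γ) (hγh : γ ≤ 1 / 2) (hε : 0 < ε₀) (hε' : 0 < ε₂₉) (hB : 0 ≤ B₃) (hB' : 0 ≤ B₃')
    (ha₀ : 0 < a₀) (ha₁ : 0 < a₁) (Zr : (q : B12.RunParams) → TkResidualW F N (FluctV N) q.K)
    (hP : (Stage13HParams.ofHistoryBlind F N ⟨theta13OfThm1CCMW F N j γ ε₀ ε₂₉ B₃ B₃' a₀ a₁, Zr⟩).Provisos₁₃SepCoPH F N) :
    (gaussPinH (Stage13HParams.ofHistoryBlind F N ⟨theta13OfThm1CCMW F N j γ ε₀ ε₂₉ B₃ B₃' a₀ a₁, Zr⟩)).Provisos₁₃SepCoPH F N ∧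
      ((gaussPinH (Stage13HParams.ofHistoryBlind F N ⟨theta13OfThm1CCMW F N j γ ε₀ ε₂₉ B₃ B₃' a₀ a₁, Zr⟩)).ZhUnity F N ∧
        (gaussPinH (Stage13HParams.ofHistoryBlind F N ⟨theta13OfThm1CCMW F N j γ ε₀ ε₂₉ B₃ B₃' a₀ a₁, Zr⟩)).SlotsNondegenerate₁₃ F N) ∧
      (gaussPinH (Stage13HParams.ofHistoryBlind F N ⟨theta13OfThm1CCMW F N j γ ε₀ ε₂₉ B₃ B₃' a₀ a₁, Zr⟩)).Admissible F N :=
  antecedent_gaussPinH hP (slotsNondegenerate₁₃_theta13OfThm1CCMW F N j γ ε₀ ε₂₉ B₃ B₃' a₀ a₁)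
    (admissible_theta13OfThm1CCMW_of_le_half F N hγ₀ hγh hε hε' hB hB' ha₀ ha₁)

/-- **★ K⁷'s ANTECEDENT AT `θᴳ` KEYED ON dag-n24-c's DOOR LETTERS** (Part 14 §0c: the window `0 < γ ≤ ½`, the six signs, (8) `VariationalThm1RegSepCoP7M`, the floor `c ≤ L^j`, [15] Sect. F's
R (9)-step `Gauge9RegSepTopStepR`, the SIGN-FREE windowed β-box of `betaOfRecord₁₃ F N θ₁₅ᶜᶜᴹᵂ` with letters `−bₗ·γ² ≤ 3`, `β'·γ² ≤ ¾`) at `Zr := ZrOfRecord₁₃ F N θ₁₅ᶜᶜᴹᵂ`.  CONDITIONAL on the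
door letters; nothing of Bałaban asserted; K0⁷ ∕ K1⁷ NOT closed.
[cite: Balaban1985Variational, Thm 1 (8)–(9) p.279, Prop. 8 p.304; Balaban1988Convergent, Thm 1 p.262, (2.6)–(2.8) pp.255–256, (2.21) p.258, (3.16)–(3.23) pp.268–270; Balaban1987RG1, Thm 1 p.255, §1 p.264; Balaban1989LargeFieldI, (0.2)–(0.4) p.176 (bookkeeping)] -/
theorem antecedent_gaussPinH_theta13OfThm1CCMW_of_gauge9TopStepR_of_betaBoxSignFree_allTorus_door {c : ℕ} (hγ₀ : 0 < γ) (hγh : γ ≤ 1 / 2)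
    (hε : 0 < ε₀) (hε' : 0 < ε₂₉) (hB : 0 ≤ B₃) (hB' : 0 ≤ B₃') (ha₀ : 0 < a₀) (ha₁ : 0 < a₁)
    (h15 : VariationalThm1RegSepCoP7M F N B₃ a₀ a₁) (hc : c ≤ F.L ^ j)
    (h9 : Gauge9RegSepTopStepR F N (fun ν K Ω => suppDomOfRecord F ν K Ω) (F.L ^ j) c B₃ B₃' a₀ a₁)
    {bl β' : ℝ} (hbox : BetaLowerH bl γ (betaOfRecord₁₃ F N (theta13OfThm1CCMW F N j γ ε₀ ε₂₉ B₃ B₃' a₀ a₁)))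
    (hbox' : BetaUpperH β' γ (betaOfRecord₁₃ F N (theta13OfThm1CCMW F N j γ ε₀ ε₂₉ B₃ B₃' a₀ a₁))) (hl : -bl * γ ^ 2 ≤ 3) (hβ' : β' * γ ^ 2 ≤ 3 / 4) :
    (gaussPinH (Stage13HParams.ofHistoryBlind F N ⟨theta13OfThm1CCMW F N j γ ε₀ ε₂₉ B₃ B₃' a₀ a₁, ZrOfRecord₁₃ F N (theta13OfThm1CCMW F N j γ ε₀ ε₂₉ B₃ B₃' a₀ a₁)⟩)).Provisos₁₃SepCoPH F N ∧
      ((gaussPinH (Stage13HParams.ofHistoryBlind F N ⟨theta13OfThm1CCMW F N j γ ε₀ ε₂₉ B₃ B₃' a₀ a₁, ZrOfRecord₁₃ F N (theta13OfThm1CCMW F N j γ ε₀ ε₂₉ B₃ B₃' a₀ a₁)⟩)).ZhUnity F N ∧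
        (gaussPinH (Stage13HParams.ofHistoryBlind F N ⟨theta13OfThm1CCMW F N j γ ε₀ ε₂₉ B₃ B₃' a₀ a₁, ZrOfRecord₁₃ F N (theta13OfThm1CCMW F N j γ ε₀ ε₂₉ B₃ B₃' a₀ a₁)⟩)).SlotsNondegenerate₁₃ F N) ∧
      (gaussPinH (Stage13HParams.ofHistoryBlind F N ⟨theta13OfThm1CCMW F N j γ ε₀ ε₂₉ B₃ B₃' a₀ a₁, ZrOfRecord₁₃ F N (theta13OfThm1CCMW F N j γ ε₀ ε₂₉ B₃ B₃' a₀ a₁)⟩)).Admissible F N :=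
  antecedent_gaussPinH_ofHistoryBlind_theta13OfThm1CCMW hγ₀ hγh hε hε' hB hB' ha₀ ha₁ _
    (N24_provisos₁₃SepCoPH_door_theta13OfThm1CCMW_of_gauge9TopStepR_of_betaBoxSignFree_allTorus hγ₀ hγh hε hε' hB hB' ha₀ ha₁ h15 hc h9 hbox hbox' hl hβ')

/-- The door provisos at `θᴳ` alone (the `hP` slot of the generic door theorem `N24_stabilityBR13SepCoPH_thetaShape20_rebindX_fourPin_pointed` at `θ := θᴳ`).
[cite: Balaban1988Convergent, Thm 1 p.262, (3.16)–(3.22) pp.268–269; Balaban1985Variational, Thm 1 (8)–(9) p.279 (bookkeeping)] -/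
theorem provisos₁₃SepCoPH_gaussPinH_theta13OfThm1CCMW_door {c : ℕ} (hγ₀ : 0 < γ) (hγh : γ ≤ 1 / 2)
    (hε : 0 < ε₀) (hε' : 0 < ε₂₉) (hB : 0 ≤ B₃) (hB' : 0 ≤ B₃') (ha₀ : 0 < a₀) (ha₁ : 0 < a₁)
    (h15 : VariationalThm1RegSepCoP7M F N B₃ a₀ a₁) (hc : c ≤ F.L ^ j)
    (h9 : Gauge9RegSepTopStepR F N (fun ν K Ω => suppDomOfRecord F ν K Ω) (F.L ^ j) c B₃ B₃' a₀ a₁)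
    {bl β' : ℝ} (hbox : BetaLowerH bl γ (betaOfRecord₁₃ F N (theta13OfThm1CCMW F N j γ ε₀ ε₂₉ B₃ B₃' a₀ a₁)))
    (hbox' : BetaUpperH β' γ (betaOfRecord₁₃ F N (theta13OfThm1CCMW F N j γ ε₀ ε₂₉ B₃ B₃' a₀ a₁))) (hl : -bl * γ ^ 2 ≤ 3) (hβ' : β' * γ ^ 2 ≤ 3 / 4) :
    (gaussPinH (Stage13HParams.ofHistoryBlind F N ⟨theta13OfThm1CCMW F N j γ ε₀ ε₂₉ B₃ B₃' a₀ a₁, ZrOfRecord₁₃ F N (theta13OfThm1CCMW F N j γ ε₀ ε₂₉ B₃ B₃' a₀ a₁)⟩)).Provisos₁₃SepCoPH F N :=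
  (antecedent_gaussPinH_theta13OfThm1CCMW_of_gauge9TopStepR_of_betaBoxSignFree_allTorus_door hγ₀ hγh hε hε' hB hB' ha₀ ha₁ h15 hc h9 hbox hbox' hl hβ').1

/-- The unity ∧ non-degeneracy guard at `θᴳ` — UNCONDITIONAL (the `hU` slot of the generic door theorem at `θ := θᴳ`; general `Zr`).
[cite: Balaban1988Convergent, (1.11) p.248, (3.16)–(3.22) pp.268–269; Balaban1989LargeFieldI, (0.2)–(0.3) p.176 (bookkeeping)] -/
theorem zhUnity_slotsNondegenerate₁₃_gaussPinH_ofHistoryBlind_theta13OfThm1CCMW (Zr : (q : B12.RunParams) → TkResidualW F N (FluctV N) q.K) :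
    (gaussPinH (Stage13HParams.ofHistoryBlind F N ⟨theta13OfThm1CCMW F N j γ ε₀ ε₂₉ B₃ B₃' a₀ a₁, Zr⟩)).ZhUnity F N ∧
      (gaussPinH (Stage13HParams.ofHistoryBlind F N ⟨theta13OfThm1CCMW F N j γ ε₀ ε₂₉ B₃ B₃' a₀ a₁, Zr⟩)).SlotsNondegenerate₁₃ F N :=
  ⟨BalabanUVNodesN11GaussianCertificateRows.zhUnity_of_gaussCert _ (gaussPinH_ζ0 _), slotsNondegenerate₁₃_theta13OfThm1CCMW F N j γ ε₀ ε₂₉ B₃ B₃' a₀ a₁⟩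

/-- Admissibility at `θᴳ` from the window + six signs (the `hθ` slot of the generic door theorem at `θ := θᴳ`; general `Zr`).
[cite: Balaban1988Convergent, (2.6)–(2.8) pp.255–256; Balaban1987RG1, Thm 1 p.259; Balaban1989LargeFieldI, (0.4) p.176 (bookkeeping)] -/
theorem admissible_gaussPinH_ofHistoryBlind_theta13OfThm1CCMW (hγ₀ : 0 < γ) (hγh : γ ≤ 1 / 2) (hε : 0 < ε₀) (hε' : 0 < ε₂₉) (hB : 0 ≤ B₃) (hB' : 0 ≤ B₃')
    (ha₀ : 0 < a₀) (ha₁ : 0 < a₁) (Zr : (q : B12.RunParams) → TkResidualW F N (FluctV N) q.K) :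
    (gaussPinH (Stage13HParams.ofHistoryBlind F N ⟨theta13OfThm1CCMW F N j γ ε₀ ε₂₉ B₃ B₃' a₀ a₁, Zr⟩)).Admissible F N :=
  admissible_theta13OfThm1CCMW_of_le_half F N hγ₀ hγh hε hε' hB hB' ha₀ ha₁

end Antecedent

/-! ## §2  N11's `hT` binder, the `h11` TYPE, Theorem 1, `Dag.B14_main` and Theorem p.245 AS PRINTED at `θᴳ` — from `hrec` + `SupplierObligations` + `OperandRowsAlongChain`, nothing else -/

section N11Side

variable {j : ℕ} {γ ε₀ ε₂₉ B₃ B₃' a₀ a₁ : ℝ} (Zr : (q : B12.RunParams) → TkResidualW F N (FluctV N) q.K)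

/-- **★★★ N11's `hT` BINDER AT `θᴳ`** (= the `hT` binder of 34H §1 `N24_h11_theta13OfThm1CCMW_of_thmP245_laws` under `θᴴ ↦ θᴳ`): `∀ P k, k < P.K → SLaw₁₃CoPH θᴳ P k → TLaw₁₃CoPH θᴳ P k` from
`hrec : θᴴ.Provisos₁₃CoPH` (e.g. `hP.toCore` of any door proof), a supplier per run AT `θᴳ` with [III] §3's `SupplierObligations` and def-T's `OperandRowsAlongChain` — the no-expansion
half of `SupplyChainAt` DISCHARGED in the Gaussian-certificate class (dag-n11-e g19 p606248 §3c at `hθ := rfl`); window + six signs.  CONDITIONAL; N11 NOT discharged; K1⁷ NOT closed.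
[cite: Balaban1988Convergent, Theorem p.245, Thm 1 p.262, remark p.262, §3 p.279, (3.23)–(3.25) p.270, (2.21) p.258; Balaban1987RG1, Thm 1 p.259; Balaban1989LargeFieldI, (0.2)–(0.4) p.176] -/
theorem hT_gaussPinH_ofHistoryBlind_theta13OfThm1CCMW_of_obligations_of_operandRows (hγ₀ : 0 < γ) (hγh : γ ≤ 1 / 2) (hε : 0 < ε₀) (hε' : 0 < ε₂₉)
    (hB : 0 ≤ B₃) (hB' : 0 ≤ B₃') (ha₀ : 0 < a₀) (ha₁ : 0 < a₁)
    (hrec : (Stage13HParams.ofHistoryBlind F N ⟨theta13OfThm1CCMW F N j γ ε₀ ε₂₉ B₃ B₃' a₀ a₁, Zr⟩).Provisos₁₃CoPH F N)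
    (σ : (P : B12.RunParams) → Sect3Supplier (gaussPinH (Stage13HParams.ofHistoryBlind F N ⟨theta13OfThm1CCMW F N j γ ε₀ ε₂₉ B₃ B₃' a₀ a₁, Zr⟩)) P)
    (hσ : ∀ P, SupplierObligations (gaussPinH (Stage13HParams.ofHistoryBlind F N ⟨theta13OfThm1CCMW F N j γ ε₀ ε₂₉ B₃ B₃' a₀ a₁, Zr⟩)) P (σ P))
    (hops : ∀ P, OperandRowsAlongChain (gaussPinH (Stage13HParams.ofHistoryBlind F N ⟨theta13OfThm1CCMW F N j γ ε₀ ε₂₉ B₃ B₃' a₀ a₁, Zr⟩)) P (σ P)) :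
    ∀ (P : B12.RunParams) (k : ℕ), k < P.K →
      SLaw₁₃CoPH F N (gaussPinH (Stage13HParams.ofHistoryBlind F N ⟨theta13OfThm1CCMW F N j γ ε₀ ε₂₉ B₃ B₃' a₀ a₁, Zr⟩)) P k →
        TLaw₁₃CoPH F N (gaussPinH (Stage13HParams.ofHistoryBlind F N ⟨theta13OfThm1CCMW F N j γ ε₀ ε₂₉ B₃ B₃' a₀ a₁, Zr⟩)) P k :=
  thmP245Laws_all_gaussPinH_theta13OfThm1CCMWH_of_obligations_of_operandRows (θ := Stage13HParams.ofHistoryBlind F N ⟨theta13OfThm1CCMW F N j γ ε₀ ε₂₉ B₃ B₃' a₀ a₁, Zr⟩) rfl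
    hγ₀ hγh hε hε' hB hB' ha₀ ha₁ hrec σ hσ hops

/-- **THEOREM 1 OF [III], ALL LEVELS `k ≤ K`, AT `θᴳ`** from `hrec` + a supplier with its obligations + def-T's operand rows (dag-n11-e p606248 §3c, `hθ := rfl`).  CONDITIONAL.
[cite: Balaban1988Convergent, Thm 1 p.262, Theorem p.245, (3.23)–(3.25) p.270, (2.21) p.258, (1.11) p.248; Balaban1987RG1, Thm 1 p.259; Balaban1989LargeFieldI, (0.2)–(0.4) p.176] -/
theorem sLaw₁₃CoPH_all_gaussPinH_ofHistoryBlind_theta13OfThm1CCMW_of_obligations_of_operandRows {p : B12.RunParams} (hγ₀ : 0 < γ) (hγh : γ ≤ 1 / 2)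
    (hε : 0 < ε₀) (hε' : 0 < ε₂₉) (hB : 0 ≤ B₃) (hB' : 0 ≤ B₃') (ha₀ : 0 < a₀) (ha₁ : 0 < a₁)
    (hrec : (Stage13HParams.ofHistoryBlind F N ⟨theta13OfThm1CCMW F N j γ ε₀ ε₂₉ B₃ B₃' a₀ a₁, Zr⟩).Provisos₁₃CoPH F N)
    (σ : Sect3Supplier (gaussPinH (Stage13HParams.ofHistoryBlind F N ⟨theta13OfThm1CCMW F N j γ ε₀ ε₂₉ B₃ B₃' a₀ a₁, Zr⟩)) p)
    (hσ : SupplierObligations (gaussPinH (Stage13HParams.ofHistoryBlind F N ⟨theta13OfThm1CCMW F N j γ ε₀ ε₂₉ B₃ B₃' a₀ a₁, Zr⟩)) p σ)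
    (hops : OperandRowsAlongChain (gaussPinH (Stage13HParams.ofHistoryBlind F N ⟨theta13OfThm1CCMW F N j γ ε₀ ε₂₉ B₃ B₃' a₀ a₁, Zr⟩)) p σ) :
    ∀ k, k ≤ p.K → SLaw₁₃CoPH F N (gaussPinH (Stage13HParams.ofHistoryBlind F N ⟨theta13OfThm1CCMW F N j γ ε₀ ε₂₉ B₃ B₃' a₀ a₁, Zr⟩)) p k :=
  sLaw₁₃CoPH_all_gaussPinH_theta13OfThm1CCMWH_of_obligations_of_operandRows (θ := Stage13HParams.ofHistoryBlind F N ⟨theta13OfThm1CCMW F N j γ ε₀ ε₂₉ B₃ B₃' a₀ a₁, Zr⟩) rfl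
    hγ₀ hγh hε hε' hB hB' ha₀ ha₁ hrec σ hσ hops

/-- **★ N11's TYPE `h11` AT `θᴳ`'s SepCoPH DATUM IN 34H §1's SHAPE FROM THE `hT` BINDER** (sequence reading; the world, its letters `(βup, β₀, γ)` and the leaf antecedents are NOT read —
`γ₁₁ := 1`; ANY door proof `hG` keys the datum).  CONDITIONAL on `hT`; N11 NOT discharged; K1⁷ NOT closed.
[cite: Balaban1988Convergent, Theorem p.245, Thm 1 p.262, remark p.262, (3.24)–(3.25) p.270; Balaban1989LargeFieldII, Thm 1 p.355 (bookkeeping)] -/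
theorem N11_h11_gaussPinH_ofHistoryBlind_theta13OfThm1CCMW_of_laws
    (hG : (gaussPinH (Stage13HParams.ofHistoryBlind F N ⟨theta13OfThm1CCMW F N j γ ε₀ ε₂₉ B₃ B₃' a₀ a₁, Zr⟩)).Provisos₁₃SepCoPH F N)
    (hT : ∀ (P : B12.RunParams) (k : ℕ), k < P.K →
      SLaw₁₃CoPH F N (gaussPinH (Stage13HParams.ofHistoryBlind F N ⟨theta13OfThm1CCMW F N j γ ε₀ ε₂₉ B₃ B₃' a₀ a₁, Zr⟩)) P k →
        TLaw₁₃CoPH F N (gaussPinH (Stage13HParams.ofHistoryBlind F N ⟨theta13OfThm1CCMW F N j γ ε₀ ε₂₉ B₃ B₃' a₀ a₁, Zr⟩)) P k) :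
    ∀ βup β₀ : ℝ, ∃ γ₁₁ : ℝ, 0 < γ₁₁ ∧ ∀ w : WorldP,
      w.C = (datumOfRecord₁₃SepCoPH F N (gaussPinH (Stage13HParams.ofHistoryBlind F N ⟨theta13OfThm1CCMW F N j γ ε₀ ε₂₉ B₃ B₃' a₀ a₁, Zr⟩)) hG).C →
      w.βup = βup → w.β₀ = β₀ → w.γ ≤ γ₁₁ → ∀ P : B12.RunParams, (leavesP w P).b7 → (leavesP w P).b8 → (leavesP w P).b9 → (leavesP w P).b10 → (leavesP w P).b11 →
      (leavesP w P).smallCouplings → (leavesP w P).smallFieldInductive → (leavesP w P).flowControl →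
        ∀ k, k < P.K → SLaw₁₃CoPH F N (gaussPinH (Stage13HParams.ofHistoryBlind F N ⟨theta13OfThm1CCMW F N j γ ε₀ ε₂₉ B₃ B₃' a₀ a₁, Zr⟩)) P k →
          TLaw₁₃CoPH F N (gaussPinH (Stage13HParams.ofHistoryBlind F N ⟨theta13OfThm1CCMW F N j γ ε₀ ε₂₉ B₃ B₃' a₀ a₁, Zr⟩)) P k :=
  fun _ _ => ⟨1, one_pos, fun _ _ _ _ _ P _ _ _ _ _ _ _ _ k hk hS => hT P k hk hS⟩

/-- **★★★ N11's TYPE `h11` AT `θᴳ`'s SepCoPH DATUM IN 34H §1's SHAPE FROM `hrec` + `SupplierObligations` + `OperandRowsAlongChain`** (the supplier for the switch `θᴴ ↦ θᴳ` of 34H §1: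
dag-n11-e's §3c `hT` through the previous theorem; general `Zr`, any door proof `hG`).  CONDITIONAL; N11 NOT discharged; K1⁷ NOT closed.
[cite: Balaban1988Convergent, Theorem p.245, Thm 1 p.262, remark p.262, §3 p.279, (3.23)–(3.25) p.270, (2.21) p.258; Balaban1987RG1, Thm 1 p.259; Balaban1989LargeFieldI, (0.2)–(0.4) p.176; Balaban1989LargeFieldII, Thm 1 p.355 (bookkeeping)] -/
theorem N11_h11_gaussPinH_ofHistoryBlind_theta13OfThm1CCMW_of_obligations_of_operandRows (hγ₀ : 0 < γ) (hγh : γ ≤ 1 / 2) (hε : 0 < ε₀) (hε' : 0 < ε₂₉)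
    (hB : 0 ≤ B₃) (hB' : 0 ≤ B₃') (ha₀ : 0 < a₀) (ha₁ : 0 < a₁)
    (hG : (gaussPinH (Stage13HParams.ofHistoryBlind F N ⟨theta13OfThm1CCMW F N j γ ε₀ ε₂₉ B₃ B₃' a₀ a₁, Zr⟩)).Provisos₁₃SepCoPH F N)
    (hrec : (Stage13HParams.ofHistoryBlind F N ⟨theta13OfThm1CCMW F N j γ ε₀ ε₂₉ B₃ B₃' a₀ a₁, Zr⟩).Provisos₁₃CoPH F N)
    (σ : (P : B12.RunParams) → Sect3Supplier (gaussPinH (Stage13HParams.ofHistoryBlind F N ⟨theta13OfThm1CCMW F N j γ ε₀ ε₂₉ B₃ B₃' a₀ a₁, Zr⟩)) P)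
    (hσ : ∀ P, SupplierObligations (gaussPinH (Stage13HParams.ofHistoryBlind F N ⟨theta13OfThm1CCMW F N j γ ε₀ ε₂₉ B₃ B₃' a₀ a₁, Zr⟩)) P (σ P))
    (hops : ∀ P, OperandRowsAlongChain (gaussPinH (Stage13HParams.ofHistoryBlind F N ⟨theta13OfThm1CCMW F N j γ ε₀ ε₂₉ B₃ B₃' a₀ a₁, Zr⟩)) P (σ P)) :
    ∀ βup β₀ : ℝ, ∃ γ₁₁ : ℝ, 0 < γ₁₁ ∧ ∀ w : WorldP,
      w.C = (datumOfRecord₁₃SepCoPH F N (gaussPinH (Stage13HParams.ofHistoryBlind F N ⟨theta13OfThm1CCMW F N j γ ε₀ ε₂₉ B₃ B₃' a₀ a₁, Zr⟩)) hG).C →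
      w.βup = βup → w.β₀ = β₀ → w.γ ≤ γ₁₁ → ∀ P : B12.RunParams, (leavesP w P).b7 → (leavesP w P).b8 → (leavesP w P).b9 → (leavesP w P).b10 → (leavesP w P).b11 →
      (leavesP w P).smallCouplings → (leavesP w P).smallFieldInductive → (leavesP w P).flowControl →
        ∀ k, k < P.K → SLaw₁₃CoPH F N (gaussPinH (Stage13HParams.ofHistoryBlind F N ⟨theta13OfThm1CCMW F N j γ ε₀ ε₂₉ B₃ B₃' a₀ a₁, Zr⟩)) P k →
          TLaw₁₃CoPH F N (gaussPinH (Stage13HParams.ofHistoryBlind F N ⟨theta13OfThm1CCMW F N j γ ε₀ ε₂₉ B₃ B₃' a₀ a₁, Zr⟩)) P k :=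
  N11_h11_gaussPinH_ofHistoryBlind_theta13OfThm1CCMW_of_laws Zr hG
    (hT_gaussPinH_ofHistoryBlind_theta13OfThm1CCMW_of_obligations_of_operandRows Zr hγ₀ hγh hε hε' hB hB' ha₀ ha₁ hrec σ hσ hops)

/-- **N11's per-world `h11` SLOT of the generic door theorem `N24_stabilityBR13SepCoPH_thetaShape20_rebindX_fourPin_pointed` at `θ := θᴳ`** (any world `w`; leaf antecedents unread) from the
`hT` binder. [cite: Balaban1988Convergent, Theorem p.245, Thm 1 p.262 (bookkeeping)] -/
theorem h11Slot_gaussPinH_ofHistoryBlind_theta13OfThm1CCMW_of_laws (w : WorldP)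
    (hT : ∀ (P : B12.RunParams) (k : ℕ), k < P.K →
      SLaw₁₃CoPH F N (gaussPinH (Stage13HParams.ofHistoryBlind F N ⟨theta13OfThm1CCMW F N j γ ε₀ ε₂₉ B₃ B₃' a₀ a₁, Zr⟩)) P k →
        TLaw₁₃CoPH F N (gaussPinH (Stage13HParams.ofHistoryBlind F N ⟨theta13OfThm1CCMW F N j γ ε₀ ε₂₉ B₃ B₃' a₀ a₁, Zr⟩)) P k) :
    ∀ P : B12.RunParams, (leavesP w P).b7 → (leavesP w P).b8 → (leavesP w P).b9 → (leavesP w P).b10 → (leavesP w P).b11 →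
      (leavesP w P).smallCouplings → (leavesP w P).smallFieldInductive → (leavesP w P).flowControl →
        ∀ k, k < P.K → SLaw₁₃CoPH F N (gaussPinH (Stage13HParams.ofHistoryBlind F N ⟨theta13OfThm1CCMW F N j γ ε₀ ε₂₉ B₃ B₃' a₀ a₁, Zr⟩)) P k →
          TLaw₁₃CoPH F N (gaussPinH (Stage13HParams.ofHistoryBlind F N ⟨theta13OfThm1CCMW F N j γ ε₀ ε₂₉ B₃ B₃' a₀ a₁, Zr⟩)) P k :=
  fun P _ _ _ _ _ _ _ _ k hk hS => hT P k hk hS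

/-- **N11's per-world `h11` SLOT at `θ := θᴳ` from `hrec` + `SupplierObligations` + `OperandRowsAlongChain`.** CONDITIONAL; N11 NOT discharged.
[cite: Balaban1988Convergent, Theorem p.245, Thm 1 p.262, §3 p.279, (3.23)–(3.25) p.270 (bookkeeping)] -/
theorem h11Slot_gaussPinH_ofHistoryBlind_theta13OfThm1CCMW_of_obligations_of_operandRows (hγ₀ : 0 < γ) (hγh : γ ≤ 1 / 2) (hε : 0 < ε₀) (hε' : 0 < ε₂₉)
    (hB : 0 ≤ B₃) (hB' : 0 ≤ B₃') (ha₀ : 0 < a₀) (ha₁ : 0 < a₁)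
    (hrec : (Stage13HParams.ofHistoryBlind F N ⟨theta13OfThm1CCMW F N j γ ε₀ ε₂₉ B₃ B₃' a₀ a₁, Zr⟩).Provisos₁₃CoPH F N)
    (σ : (P : B12.RunParams) → Sect3Supplier (gaussPinH (Stage13HParams.ofHistoryBlind F N ⟨theta13OfThm1CCMW F N j γ ε₀ ε₂₉ B₃ B₃' a₀ a₁, Zr⟩)) P)
    (hσ : ∀ P, SupplierObligations (gaussPinH (Stage13HParams.ofHistoryBlind F N ⟨theta13OfThm1CCMW F N j γ ε₀ ε₂₉ B₃ B₃' a₀ a₁, Zr⟩)) P (σ P))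
    (hops : ∀ P, OperandRowsAlongChain (gaussPinH (Stage13HParams.ofHistoryBlind F N ⟨theta13OfThm1CCMW F N j γ ε₀ ε₂₉ B₃ B₃' a₀ a₁, Zr⟩)) P (σ P)) (w : WorldP) :
    ∀ P : B12.RunParams, (leavesP w P).b7 → (leavesP w P).b8 → (leavesP w P).b9 → (leavesP w P).b10 → (leavesP w P).b11 →
      (leavesP w P).smallCouplings → (leavesP w P).smallFieldInductive → (leavesP w P).flowControl →
        ∀ k, k < P.K → SLaw₁₃CoPH F N (gaussPinH (Stage13HParams.ofHistoryBlind F N ⟨theta13OfThm1CCMW F N j γ ε₀ ε₂₉ B₃ B₃' a₀ a₁, Zr⟩)) P k →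
          TLaw₁₃CoPH F N (gaussPinH (Stage13HParams.ofHistoryBlind F N ⟨theta13OfThm1CCMW F N j γ ε₀ ε₂₉ B₃ B₃' a₀ a₁, Zr⟩)) P k :=
  h11Slot_gaussPinH_ofHistoryBlind_theta13OfThm1CCMW_of_laws Zr w
    (hT_gaussPinH_ofHistoryBlind_theta13OfThm1CCMW_of_obligations_of_operandRows Zr hγ₀ hγh hε hε' hB hB' ha₀ ha₁ hrec σ hσ hops)

/-- **N11's NODE `Dag.B14_main (leavesP w p)` AT EVERY WORLD BOUND TO `θᴳ`'s DATUM** from `hrec` + the supplier's obligations + def-T's operand rows at `θᴳ` (dag-n11-e p606248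
`b14_main_theta13OfThm1CCMWH_of_obligations` at `θ := θᴳ`, `hθ := rfl`, the no-expansion obligation discharged by `noExpansionObligation_of_gaussCert_of_operandRows`) — the world's
ceiling letter `βup`, `β₀`, `γ`, `b`, `L`, `up` UNREAD.  CONDITIONAL; N11 NOT discharged.
[cite: Balaban1988Convergent, Thm 1 p.262, Theorem p.245, p.244 L36–38, (2.6) p.255, (2.21) p.258; Balaban1987RG1, Thm 1 p.259; Balaban1989LargeFieldII, Thm 1 p.355 (bookkeeping)] -/
theorem b14_main_gaussPinH_ofHistoryBlind_theta13OfThm1CCMW_of_obligations_of_operandRows {p : B12.RunParams} (hγ₀ : 0 < γ) (hγh : γ ≤ 1 / 2)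
    (hε : 0 < ε₀) (hε' : 0 < ε₂₉) (hB : 0 ≤ B₃) (hB' : 0 ≤ B₃') (ha₀ : 0 < a₀) (ha₁ : 0 < a₁)
    (hrec : (Stage13HParams.ofHistoryBlind F N ⟨theta13OfThm1CCMW F N j γ ε₀ ε₂₉ B₃ B₃' a₀ a₁, Zr⟩).Provisos₁₃CoPH F N)
    (σ : Sect3Supplier (gaussPinH (Stage13HParams.ofHistoryBlind F N ⟨theta13OfThm1CCMW F N j γ ε₀ ε₂₉ B₃ B₃' a₀ a₁, Zr⟩)) p)
    (hσ : SupplierObligations (gaussPinH (Stage13HParams.ofHistoryBlind F N ⟨theta13OfThm1CCMW F N j γ ε₀ ε₂₉ B₃ B₃' a₀ a₁, Zr⟩)) p σ)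
    (hops : OperandRowsAlongChain (gaussPinH (Stage13HParams.ofHistoryBlind F N ⟨theta13OfThm1CCMW F N j γ ε₀ ε₂₉ B₃ B₃' a₀ a₁, Zr⟩)) p σ)
    (w : WorldP)
    (hC : w.C = (datumOfRecord₁₃CoPH F N (gaussPinH (Stage13HParams.ofHistoryBlind F N ⟨theta13OfThm1CCMW F N j γ ε₀ ε₂₉ B₃ B₃' a₀ a₁, Zr⟩)) (provisos₁₃CoPH_gaussPinH hrec)).C) :
    Dag.B14_main (leavesP w p) :=
  b14_main_theta13OfThm1CCMWH_of_obligations (θ := gaussPinH (Stage13HParams.ofHistoryBlind F N ⟨theta13OfThm1CCMW F N j γ ε₀ ε₂₉ B₃ B₃' a₀ a₁, Zr⟩)) rfl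
    hγ₀ hγh hε hε' hB hB' ha₀ ha₁ (provisos₁₃CoPH_gaussPinH hrec) σ hσ
    (noExpansionObligation_of_gaussCert_of_operandRows (gaussPinH_ζ0 _) (gaussPinH_quad _) (provisos₁₃CoPH_gaussPinH hrec)
      (one_le_M_stage12NumericsOfThm1CCMW F j γ ε₀ B₃ B₃' a₀ a₁) σ hσ.loc hops) w hC

/-- **[III]'s THEOREM OF p. 245 AS PRINTED `B14.ThmP245PrintedI (T) ρ S Scorr K` AT `θᴳ`** (34H §2's `h245` per run under `θᴴ ↦ θᴳ`) — for any family `T` of renormalization transformations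
on the run's lattices agreeing with the tower of record on the trajectory — from `hrec` + the supplier's obligations + def-T's operand rows at `θᴳ` (the no-expansion obligation
discharged in the Gaussian-certificate class).  CONDITIONAL; N11 NOT discharged.
[cite: Balaban1988Convergent, Theorem p.245, Thm 1 p.262, remark p.262, (3.25) p.270, §3 p.279, (2.21) p.258; Balaban1987RG1, Thm 1 p.259] -/
theorem thmP245PrintedI_gaussPinH_ofHistoryBlind_theta13OfThm1CCMW_of_obligations_of_operandRows {p : B12.RunParams} (hγ₀ : 0 < γ) (hγh : γ ≤ 1 / 2)
    (hε : 0 < ε₀) (hε' : 0 < ε₂₉) (hB : 0 ≤ B₃) (hB' : 0 ≤ B₃') (ha₀ : 0 < a₀) (ha₁ : 0 < a₁)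
    (hrec : (Stage13HParams.ofHistoryBlind F N ⟨theta13OfThm1CCMW F N j γ ε₀ ε₂₉ B₃ B₃' a₀ a₁, Zr⟩).Provisos₁₃CoPH F N)
    (σ : Sect3Supplier (gaussPinH (Stage13HParams.ofHistoryBlind F N ⟨theta13OfThm1CCMW F N j γ ε₀ ε₂₉ B₃ B₃' a₀ a₁, Zr⟩)) p)
    (hσ : SupplierObligations (gaussPinH (Stage13HParams.ofHistoryBlind F N ⟨theta13OfThm1CCMW F N j γ ε₀ ε₂₉ B₃ B₃' a₀ a₁, Zr⟩)) p σ)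
    (hops : OperandRowsAlongChain (gaussPinH (Stage13HParams.ofHistoryBlind F N ⟨theta13OfThm1CCMW F N j γ ε₀ ε₂₉ B₃ B₃' a₀ a₁, Zr⟩)) p σ)
    (T : (k : ℕ) → RTOpI (F.P p.K) k (SU N) (avOfRecord F N p.K k))
    (hTT : ∀ k, k < p.K → (T k).T (densOfRecord₁₃ F N (theta13OfThm1CCMW F N j γ ε₀ ε₂₉ B₃ B₃' a₀ a₁) p k) = tdensOfRecord₁₃ F N (theta13OfThm1CCMW F N j γ ε₀ ε₂₉ B₃ B₃' a₀ a₁) p k) :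
    B14.ThmP245PrintedI T (densOfRecord₁₃ F N (theta13OfThm1CCMW F N j γ ε₀ ε₂₉ B₃ B₃' a₀ a₁) p)
      (VOfRecord₁₃CoPH F N (gaussPinH (Stage13HParams.ofHistoryBlind F N ⟨theta13OfThm1CCMW F N j γ ε₀ ε₂₉ B₃ B₃' a₀ a₁, Zr⟩)) p).S
      (VOfRecord₁₃CoPH F N (gaussPinH (Stage13HParams.ofHistoryBlind F N ⟨theta13OfThm1CCMW F N j γ ε₀ ε₂₉ B₃ B₃' a₀ a₁, Zr⟩)) p).Scorr p.K :=
  thmP245PrintedI_theta13OfThm1CCMWH_of_obligations (θ := gaussPinH (Stage13HParams.ofHistoryBlind F N ⟨theta13OfThm1CCMW F N j γ ε₀ ε₂₉ B₃ B₃' a₀ a₁, Zr⟩)) rfl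
    hγ₀ hγh hε hε' hB hB' ha₀ ha₁ (provisos₁₃CoPH_gaussPinH hrec) σ hσ
    (noExpansionObligation_of_gaussCert_of_operandRows (gaussPinH_ζ0 _) (gaussPinH_quad _) (provisos₁₃CoPH_gaussPinH hrec)
      (one_le_M_stage12NumericsOfThm1CCMW F j γ ε₀ B₃ B₃' a₀ a₁) σ hσ.loc hops) T hTT

end N11Side

/-! ## §3  N13's (R₁₃) leaf ∕ `laws₁₃CoPH` at `θᴳ` from the window + six signs (dag-n24-c Part 8 §0 at the free residual slots `(Zr, θᴳ.Zh, θᴳ.Phih)`) -/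

section RLeaf

variable {j : ℕ} {γ ε₀ ε₂₉ B₃ B₃' a₀ a₁ : ℝ} (Zr : (q : B12.RunParams) → TkResidualW F N (FluctV N) q.K) (p : B12.RunParams)

/-- **★ N13's CoPH 𝐑-leaf at `θᴳ`**: `ROpLeaf (VOfRecord₁₃CoPH F N θᴳ p)` from the window `0 < γ ≤ ½` and the six admissibility signs — dag-n11-e's GENERIC all-numerics leaf
`B16RLeafRecord13LiveCoPH.rOpLeaf_VOfRecord₁₃CoPH_theta13LiveOfNumerics` at the member, as dag-n24-c Part 8 §0 `N24_rOpLeaf_VOfRecord₁₃CoPH_theta13OfThm1CCMW` read at the slots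
`(Zr, θᴳ.Zh, θᴳ.Phih)` (`θᴳ` IS that tuple, §0 `gaussPinH_ofHistoryBlind_eq_tuple`).  NO [15] fact, NO `bg`.
[cite: Balaban1988Convergent, p.244, (3.16) p.268; Balaban1989LargeFieldI, (0.3)–(0.4) p.176, p.177 (i)–(ii); Balaban1989LargeFieldII, Thm 1 p.355 (not exercised); Balaban1987RG1, Thm 1 p.255, §1 p.264 (window)] -/
theorem N13_rOpLeaf_VOfRecord₁₃CoPH_gaussPinH_ofHistoryBlind_theta13OfThm1CCMW (hγ₀ : 0 < γ) (hγh : γ ≤ 1 / 2) (hε : 0 < ε₀) (hε' : 0 < ε₂₉) (hB : 0 ≤ B₃)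
    (hB' : 0 ≤ B₃') (ha₀ : 0 < a₀) (ha₁ : 0 < a₁) :
    ROpLeaf (VOfRecord₁₃CoPH F N (gaussPinH (Stage13HParams.ofHistoryBlind F N ⟨theta13OfThm1CCMW F N j γ ε₀ ε₂₉ B₃ B₃' a₀ a₁, Zr⟩)) p) :=
  N24_rOpLeaf_VOfRecord₁₃CoPH_theta13OfThm1CCMW Zr
    (gaussPinH (Stage13HParams.ofHistoryBlind F N ⟨theta13OfThm1CCMW F N j γ ε₀ ε₂₉ B₃ B₃' a₀ a₁, Zr⟩)).Zh
    (gaussPinH (Stage13HParams.ofHistoryBlind F N ⟨theta13OfThm1CCMW F N j γ ε₀ ε₂₉ B₃ B₃' a₀ a₁, Zr⟩)).Phih p hγ₀ hγh hε hε' hB hB' ha₀ ha₁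

/-- **★ N13's (R₁₃) SLOT IN LAW FORM AT `θᴳ`** (the `hR` slot of the generic door theorem at `θ := θᴳ`): `∀ k < K, TLaw₁₃CoPH θᴳ p k → SLaw₁₃CoPH θᴳ p (k+1)` from the window and
the six signs (Part 8 §0 `N24_laws₁₃CoPH_theta13OfThm1CCMW` at the slots `(Zr, θᴳ.Zh, θᴳ.Phih)`).
[cite: Balaban1988Convergent, p.244 (bookkeeping); Balaban1989LargeFieldI, (0.3)–(0.4) p.176; Balaban1989LargeFieldII, Thm 1 p.355 (not exercised)] -/
theorem N13_laws₁₃CoPH_gaussPinH_ofHistoryBlind_theta13OfThm1CCMW (hγ₀ : 0 < γ) (hγh : γ ≤ 1 / 2) (hε : 0 < ε₀) (hε' : 0 < ε₂₉) (hB : 0 ≤ B₃) (hB' : 0 ≤ B₃')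
    (ha₀ : 0 < a₀) (ha₁ : 0 < a₁) :
    ∀ k, k < p.K →
      TLaw₁₃CoPH F N (gaussPinH (Stage13HParams.ofHistoryBlind F N ⟨theta13OfThm1CCMW F N j γ ε₀ ε₂₉ B₃ B₃' a₀ a₁, Zr⟩)) p k →
        SLaw₁₃CoPH F N (gaussPinH (Stage13HParams.ofHistoryBlind F N ⟨theta13OfThm1CCMW F N j γ ε₀ ε₂₉ B₃ B₃' a₀ a₁, Zr⟩)) p (k + 1) :=
  N24_laws₁₃CoPH_theta13OfThm1CCMW Zr
    (gaussPinH (Stage13HParams.ofHistoryBlind F N ⟨theta13OfThm1CCMW F N j γ ε₀ ε₂₉ B₃ B₃' a₀ a₁, Zr⟩)).Zh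
    (gaussPinH (Stage13HParams.ofHistoryBlind F N ⟨theta13OfThm1CCMW F N j γ ε₀ ε₂₉ B₃ B₃' a₀ a₁, Zr⟩)).Phih p hγ₀ hγh hε hε' hB hB' ha₀ ha₁

/-- N13's (R₁₃) slot at `θᴳ` for ALL runs at once (the literal `hR` binder shape `∀ P k, k < P.K → TLaw → SLaw (k+1)`). [cite: Balaban1988Convergent, p.244 (bookkeeping)] -/
theorem N13_laws₁₃CoPH_all_gaussPinH_ofHistoryBlind_theta13OfThm1CCMW (hγ₀ : 0 < γ) (hγh : γ ≤ 1 / 2) (hε : 0 < ε₀) (hε' : 0 < ε₂₉) (hB : 0 ≤ B₃)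
    (hB' : 0 ≤ B₃') (ha₀ : 0 < a₀) (ha₁ : 0 < a₁) :
    ∀ (P : B12.RunParams) (k : ℕ), k < P.K →
      TLaw₁₃CoPH F N (gaussPinH (Stage13HParams.ofHistoryBlind F N ⟨theta13OfThm1CCMW F N j γ ε₀ ε₂₉ B₃ B₃' a₀ a₁, Zr⟩)) P k →
        SLaw₁₃CoPH F N (gaussPinH (Stage13HParams.ofHistoryBlind F N ⟨theta13OfThm1CCMW F N j γ ε₀ ε₂₉ B₃ B₃' a₀ a₁, Zr⟩)) P (k + 1) :=
  fun P => N13_laws₁₃CoPH_gaussPinH_ofHistoryBlind_theta13OfThm1CCMW Zr P hγ₀ hγh hε hε' hB hB' ha₀ ha₁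

end RLeaf

end Summit.QuantumFields.YangMills.Theorems.BalabanUVNodesN11K1WitnessGaussPinH

end
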